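import Summits.CriticalPhenomena.PercolationContinuityZ3.Theorems.PercNearOneGluingNoHeavyLowerTailMajorityGluingZFourteenEightHG1
import Summits.CriticalPhenomena.PercolationContinuityZ3.Theorems.PercNearOneGluingNoHeavyLowerTailMajorityGluingZFourteenEightHG2
import Summits.CriticalPhenomena.PercolationContinuityZ3.Theorems.PercNearOneGluingNoHeavyLowerTailMajorityGluingZFourteenEightHG3
import Summits.CriticalPhenomena.PercolationContinuityZ3.Theorems.PercNearOneGluingNoHeavyLowerTailMajorityGluingZFourteenEightHG4
import Summits.CriticalPhenomena.PercolationContinuityZ3.Theorems.PercNearOneGluingNoHeavyLowerTailMajorityGluingZFourteenEightHG5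
import Summits.CriticalPhenomena.PercolationContinuityZ3.Theorems.PercNearOneGluingNoHeavyLowerTailMajorityGluingZFourteenEightHG6
import Summits.CriticalPhenomena.PercolationContinuityZ3.Theorems.PercNearOneGluingNoHeavyLowerTailMajorityGluingZFourteenEightHG7
import Summits.CriticalPhenomena.PercolationContinuityZ3.Theorems.PercNearOneGluingNoHeavyLowerTailMajorityGluingZFourteenEightHR1
import Summits.CriticalPhenomena.PercolationContinuityZ3.Theorems.PercNearOneGluingNoHeavyLowerTailMajorityGluingZFourteenEightHR2
import Summits.CriticalPhenomena.PercolationContinuityZ3.Theorems.PercNearOneGluingNoHeavyLowerTailMajorityGluingZFourteenEightHR3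
import Summits.CriticalPhenomena.PercolationContinuityZ3.Theorems.PercNearOneGluingNoHeavyLowerTailMajorityGluingZFourteenEightHR4
import Summits.CriticalPhenomena.PercolationContinuityZ3.Theorems.PercNearOneGluingNoHeavyLowerTailMajorityGluingZFourteenEightHR5
import Summits.CriticalPhenomena.PercolationContinuityZ3.Theorems.PercNearOneGluingNoHeavyLowerTailMajorityGluingZFourteenEightHR6
import HarnessLib

/-!
# The degree-3 orbit certificate of the cell `(14,8)` at `c = 3/2`, glued HIERARCHICALLY from 73 spec-only Z parts (7 groups × 6 key ranges) (lane prim-rate, constants-miner 1, gen 39; cert/mkhier.py)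

Support file for the closed crux `NoHeavyLowerTail` (stmt-CriticalPhenomena-4575), majority-gluing line.  A SYMMETRISED DEGREE-3 certificate (`…MajorityGluingQCertSym3`) for
«at least 8 of 14 relays cut»: `μ(8 ≤ #cut) ≤ (3/2)·δ` (kit j310356: engine T — the LP in type space — over a cutting-plane pool; exact integer multipliers re-verified in type
space by cert/mksym3z.py: every orbit sum ≥ 0).  73 Z parts (`…ZFourteenEightP*`, cheap checks + fast digests verified part by part); 7 group files (`…ZFourteenEightHG*`: the group's
aggregate-merge tree equals its 6 key-range chunk literals `…ZFourteenEightHG*C*`); 6 range files (`…ZFourteenEightHR*`: the merged chunks of a key range pass the run check).  Here: `SymCert3.concat`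
of the parts' translations, `checkW3S` from `SymCert3Z.checkW3S_concatZ`, and `fourteenEightT2_pos` by LINEAR ASSEMBLY: value of the glued contribution list = Σ parts' digest values
(`SymCert3Z.map_evalC_of_digestsZ2`) = Σ groups' chunk values (`…G*_val`) = Σ ranges' chunk values ≥ 0 (`…R*_nonneg`).  (Why hierarchical: one merge of all 242 643 digest entries
exhausts the kernel, and an aggregated digest literal exceeds the gate's 200 kB file limit.)  No sorries. [cite: VandenbergKahn2001, Thm 1.2 (p. 123)]
-/

namespace Summit.CriticalPhenomena.PercolationContinuityZ3.Theorems

namespace HubOnly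
namespace QCert

/-- The cell parameters `(14,8)`, `c = 3/2`. -/
def fourteenEightT2Base : Cert := ⟨14, 8, 3, 2, 1, [], [], []⟩

/-- The spec parts. -/
def fourteenEightT2Parts : List SymCert3Z := [fourteenEightTP1, fourteenEightTP2, fourteenEightTP3, fourteenEightTP4, fourteenEightTP5, fourteenEightTP6, fourteenEightTP7, fourteenEightTP8, fourteenEightTP9, fourteenEightTP10, fourteenEightTP11, fourteenEightTP12, fourteenEightTP13, fourteenEightTP14, fourteenEightTP15, fourteenEightTP16, fourteenEightTP17, fourteenEightTP18, fourteenEightTP19, fourteenEightTP20, fourteenEightTP21, fourteenEightTP22, fourteenEightTP23, fourteenEightTP24, fourteenEightTP25, fourteenEightTP26, fourteenEightTP27, fourteenEightTP28, fourteenEightTP29, fourteenEightTP30, fourteenEightTP31, fourteenEightTP32, fourteenEightTP33, fourteenEightTP34, fourteenEightTP35, fourteenEightTP36, fourteenEightTP37, fourteenEightTP38, fourteenEightTP39, fourteenEightTP40, fourteenEightTP41, fourteenEightTP42, fourteenEightTP43, fourteenEightTP44, fourteenEightTP45, fourteenEightTP46, fourteenEightTP47, fourteenEightTP48, fourteenEightTP49,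 fourteenEightTP50, fourteenEightTP51, fourteenEightTP52, fourteenEightTP53, fourteenEightTP54, fourteenEightTP55, fourteenEightTP56, fourteenEightTP57, fourteenEightTP58, fourteenEightTP59, fourteenEightTP60, fourteenEightTP61, fourteenEightTP62, fourteenEightTP63, fourteenEightTP64, fourteenEightTP65, fourteenEightTP66, fourteenEightTP67, fourteenEightTP68, fourteenEightTP69, fourteenEightTP70, fourteenEightTP71, fourteenEightTP72, fourteenEightTP73]

/-- **The degree-3 orbit certificate of `(14,8)` at `c = 3/2`**: the concatenation of the parts' translations. -/
def fourteenEightT2 : SymCert3 := SymCert3.concat fourteenEightT2Base (List.map SymCert3Z.toS fourteenEightT2Parts)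

/-- All parts carry the cell parameters. -/
theorem fourteenEightT2_bases : ∀ d ∈ fourteenEightT2Parts, d.base = fourteenEightT2Base := by
  unfold fourteenEightT2Parts
  intro d hd
  simp only [List.mem_cons, List.mem_nil_iff, or_false] at hd
  rcases hd with rfl | rfl | rfl | rfl | rfl | rfl | rfl | rfl | rfl | rfl | rfl | rfl | rfl | rfl | rfl | rfl | rfl | rfl | rfl | rfl | rfl | rfl | rfl | rfl | rfl | rfl | rfl | rfl | rfl | rfl | rfl | rfl | rfl | rfl | rfl | rfl | rfl | rfl | rfl | rfl | rfl | rfl | rfl | rfl | rfl | rfl | rfl | rfl | rfl | rfl | rfl | rfl | rfl | rfl | rfl | rfl | rfl | rfl | rfl | rfl | rfl | rfl | rfl | rfl | rfl | rfl | rfl | rfl | rfl | rfl | rfl | rfl | rfl <;> rfl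

/-- All parts pass the cheap entry-wise check. -/
theorem fourteenEightT2_wf : ∀ d ∈ fourteenEightT2Parts, d.wfZ = true := by
  unfold fourteenEightT2Parts
  intro d hd
  simp only [List.mem_cons, List.mem_nil_iff, or_false] at hd
  rcases hd with rfl | rfl | rfl | rfl | rfl | rfl | rfl | rfl | rfl | rfl | rfl | rfl | rfl | rfl | rfl | rfl | rfl | rfl | rfl | rfl | rfl | rfl | rfl | rfl | rfl | rfl | rfl | rfl | rfl | rfl | rfl | rfl | rfl | rfl | rfl | rfl | rfl | rfl | rfl | rfl | rfl | rfl | rfl | rfl | rfl | rfl | rfl | rfl | rfl | rfl | rfl | rfl | rfl | rfl | rfl | rfl | rfl | rfl | rfl | rfl | rfl | rfl | rfl | rfl | rfl | rfl | rfl | rfl | rfl | rfl | rfl | rfl | rfl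
  exacts [fourteenEightTP1_wf, fourteenEightTP2_wf, fourteenEightTP3_wf, fourteenEightTP4_wf, fourteenEightTP5_wf, fourteenEightTP6_wf, fourteenEightTP7_wf, fourteenEightTP8_wf, fourteenEightTP9_wf, fourteenEightTP10_wf, fourteenEightTP11_wf, fourteenEightTP12_wf, fourteenEightTP13_wf, fourteenEightTP14_wf, fourteenEightTP15_wf, fourteenEightTP16_wf, fourteenEightTP17_wf, fourteenEightTP18_wf, fourteenEightTP19_wf, fourteenEightTP20_wf, fourteenEightTP21_wf, fourteenEightTP22_wf, fourteenEightTP23_wf, fourteenEightTP24_wf, fourteenEightTP25_wf, fourteenEightTP26_wf, fourteenEightTP27_wf, fourteenEightTP28_wf, fourteenEightTP29_wf, fourteenEightTP30_wf, fourteenEightTP31_wf, fourteenEightTP32_wf, fourteenEightTP33_wf, fourteenEightTP34_wf, fourteenEightTP35_wf, fourteenEightTP36_wf, fourteenEightTP37_wf, fourteenEightTP38_wf, fourteenEightTP39_wf, fourteenEightTP40_wf, fourteenEightTP41_wf, fourteenEightTP42_wf, fourteenEightTP43_wf, fourteenEightTP44_wf, fourteenEightTP45_wf, fourteenEightTP46_wf,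 fourteenEightTP47_wf, fourteenEightTP48_wf, fourteenEightTP49_wf, fourteenEightTP50_wf, fourteenEightTP51_wf, fourteenEightTP52_wf, fourteenEightTP53_wf, fourteenEightTP54_wf, fourteenEightTP55_wf, fourteenEightTP56_wf, fourteenEightTP57_wf, fourteenEightTP58_wf, fourteenEightTP59_wf, fourteenEightTP60_wf, fourteenEightTP61_wf, fourteenEightTP62_wf, fourteenEightTP63_wf, fourteenEightTP64_wf, fourteenEightTP65_wf, fourteenEightTP66_wf, fourteenEightTP67_wf, fourteenEightTP68_wf, fourteenEightTP69_wf, fourteenEightTP70_wf, fourteenEightTP71_wf, fourteenEightTP72_wf, fourteenEightTP73_wf]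

/-- The base of the glued certificate. -/
theorem fourteenEightT2_base : fourteenEightT2.base = fourteenEightT2Base := SymCert3.concat_base _ _ (SymCert3Z.toS_bases _ _ fourteenEightT2_bases)

/-- Its number of relays. -/
theorem fourteenEightT2_m : fourteenEightT2.base.m = 14 := by
  rw [fourteenEightT2_base]; rfl

/-- The `δ²`-weight of the glued multiplier is positive. -/
theorem fourteenEightT2_DD : 0 < fourteenEightT2.ell2DDS := by
  decide +kernel

/-- **The structure check of the glued certificate.** -/
theorem fourteenEightT2_checkWS : fourteenEightT2.checkW3S = true :=
  SymCert3Z.checkW3S_concatZ fourteenEightT2Base fourteenEightT2Parts fourteenEightT2_bases fourteenEightT2_wf (by decide) (by decide) fourteenEightT2_DD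

/-- The parts' type-space digests. -/
theorem fourteenEightT2_digests : List.Forall₂ (fun d dg => d.digestZ2 24 = dg) fourteenEightT2Parts [fourteenEightTP1D, fourteenEightTP2D, fourteenEightTP3D, fourteenEightTP4D, fourteenEightTP5D, fourteenEightTP6D, fourteenEightTP7D, fourteenEightTP8D, fourteenEightTP9D, fourteenEightTP10D, fourteenEightTP11D, fourteenEightTP12D, fourteenEightTP13D, fourteenEightTP14D, fourteenEightTP15D, fourteenEightTP16D, fourteenEightTP17D, fourteenEightTP18D, fourteenEightTP19D, fourteenEightTP20D, fourteenEightTP21D, fourteenEightTP22D, fourteenEightTP23D, fourteenEightTP24D, fourteenEightTP25D, fourteenEightTP26D, fourteenEightTP27D, fourteenEightTP28D, fourteenEightTP29D, fourteenEightTP30D, fourteenEightTP31D, fourteenEightTP32D, fourteenEightTP33D, fourteenEightTP34D, fourteenEightTP35D, fourteenEightTP36D, fourteenEightTP37D, fourteenEightTP38D, fourteenEightTP39D, fourteenEightTP40D, fourteenEightTP41D, fourteenEightTP42D, fourteenEightTP43D, fourteenEightTP44D, fourteenEightTP45D, fourteenEightTP46D, fourteenEightTP47D, fourteenEightTP48D,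 fourteenEightTP49D, fourteenEightTP50D, fourteenEightTP51D, fourteenEightTP52D, fourteenEightTP53D, fourteenEightTP54D, fourteenEightTP55D, fourteenEightTP56D, fourteenEightTP57D, fourteenEightTP58D, fourteenEightTP59D, fourteenEightTP60D, fourteenEightTP61D, fourteenEightTP62D, fourteenEightTP63D, fourteenEightTP64D, fourteenEightTP65D, fourteenEightTP66D, fourteenEightTP67D, fourteenEightTP68D, fourteenEightTP69D, fourteenEightTP70D, fourteenEightTP71D, fourteenEightTP72D, fourteenEightTP73D] :=
  List.Forall₂.cons fourteenEightTP1_digest (List.Forall₂.cons fourteenEightTP2_digest (List.Forall₂.cons fourteenEightTP3_digest (List.Forall₂.cons fourteenEightTP4_digest (List.Forall₂.cons fourteenEightTP5_digest (List.Forall₂.cons fourteenEightTP6_digest (List.Forall₂.cons fourteenEightTP7_digest (List.Forall₂.cons fourteenEightTP8_digest (List.Forall₂.cons fourteenEightTP9_digest (List.Forall₂.cons fourteenEightTP10_digest (List.Forall₂.cons fourteenEightTP11_digest (List.Forall₂.cons fourteenEightTP12_digest (List.Forall₂.cons fourteenEightTP13_digest (List.Forall₂.cons fourteenEightTP14_digest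 (List.Forall₂.cons fourteenEightTP15_digest (List.Forall₂.cons fourteenEightTP16_digest (List.Forall₂.cons fourteenEightTP17_digest (List.Forall₂.cons fourteenEightTP18_digest (List.Forall₂.cons fourteenEightTP19_digest (List.Forall₂.cons fourteenEightTP20_digest (List.Forall₂.cons fourteenEightTP21_digest (List.Forall₂.cons fourteenEightTP22_digest (List.Forall₂.cons fourteenEightTP23_digest (List.Forall₂.cons fourteenEightTP24_digest (List.Forall₂.cons fourteenEightTP25_digest (List.Forall₂.cons fourteenEightTP26_digest (List.Forall₂.cons fourteenEightTP27_digest (List.Forall₂.cons fourteenEightTP28_digest (List.Forall₂.cons fourteenEightTP29_digest (List.Forall₂.cons fourteenEightTP30_digest (List.Forall₂.cons fourteenEightTP31_digest (List.Forall₂.cons fourteenEightTP32_digest (List.Forall₂.cons fourteenEightTP33_digest (List.Forall₂.cons fourteenEightTP34_digest (List.Forall₂.cons fourteenEightTP35_digest (List.Forall₂.cons fourteenEightTP36_digest (List.Forall₂.cons fourteenEightTP37_digest (List.Forall₂.cons fourteenEightTP38_digest (List.Forall₂.cons fourteenEightTP39_digest (List.Forall₂.cons fourteenEightTP40_digest (List.Forall₂.cons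 fourteenEightTP41_digest (List.Forall₂.cons fourteenEightTP42_digest (List.Forall₂.cons fourteenEightTP43_digest (List.Forall₂.cons fourteenEightTP44_digest (List.Forall₂.cons fourteenEightTP45_digest (List.Forall₂.cons fourteenEightTP46_digest (List.Forall₂.cons fourteenEightTP47_digest (List.Forall₂.cons fourteenEightTP48_digest (List.Forall₂.cons fourteenEightTP49_digest (List.Forall₂.cons fourteenEightTP50_digest (List.Forall₂.cons fourteenEightTP51_digest (List.Forall₂.cons fourteenEightTP52_digest (List.Forall₂.cons fourteenEightTP53_digest (List.Forall₂.cons fourteenEightTP54_digest (List.Forall₂.cons fourteenEightTP55_digest (List.Forall₂.cons fourteenEightTP56_digest (List.Forall₂.cons fourteenEightTP57_digest (List.Forall₂.cons fourteenEightTP58_digest (List.Forall₂.cons fourteenEightTP59_digest (List.Forall₂.cons fourteenEightTP60_digest (List.Forall₂.cons fourteenEightTP61_digest (List.Forall₂.cons fourteenEightTP62_digest (List.Forall₂.cons fourteenEightTP63_digest (List.Forall₂.cons fourteenEightTP64_digest (List.Forall₂.cons fourteenEightTP65_digest (List.Forall₂.cons fourteenEightTP66_digest (List.Forall₂.cons fourteenEightTP67_digest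 (List.Forall₂.cons fourteenEightTP68_digest (List.Forall₂.cons fourteenEightTP69_digest (List.Forall₂.cons fourteenEightTP70_digest (List.Forall₂.cons fourteenEightTP71_digest (List.Forall₂.cons fourteenEightTP72_digest (List.Forall₂.cons fourteenEightTP73_digest (List.Forall₂.nil)))))))))))))))))))))))))))))))))))))))))))))))))))))))))))))))))))))))))

set_option maxHeartbeats 4000000 in
/-- **The whole contribution list evaluates nonnegatively at every nonnegative key valuation.** -/
theorem fourteenEightT2_pos : ∀ val : ℕ → ℝ, (∀ key, 0 ≤ val key) → 0 ≤ evalC val fourteenEightT2.contribs3S := by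
  intro val hval
  have hg1 := fourteenEightT2G1_val val
  have hg2 := fourteenEightT2G2_val val
  have hg3 := fourteenEightT2G3_val val
  have hg4 := fourteenEightT2G4_val val
  have hg5 := fourteenEightT2G5_val val
  have hg6 := fourteenEightT2G6_val val
  have hg7 := fourteenEightT2G7_val val
  have hr1 := fourteenEightT2R1_nonneg val hval
  have hr2 := fourteenEightT2R2_nonneg val hval
  have hr3 := fourteenEightT2R3_nonneg val hval
  have hr4 := fourteenEightT2R4_nonneg val hval
  have hr5 := fourteenEightT2R5_nonneg val hval
  have hr6 := fourteenEightT2R6_nonneg val hval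
  show 0 ≤ evalC val (SymCert3.concat fourteenEightT2Base (List.map SymCert3Z.toS fourteenEightT2Parts)).contribs3S
  rw [SymCert3.evalC_concat3 fourteenEightT2Base val (List.map SymCert3Z.toS fourteenEightT2Parts) (SymCert3Z.toS_bases _ _ fourteenEightT2_bases),
    SymCert3Z.map_evalC_of_digestsZ2 24 val fourteenEightT2_wf fourteenEightT2_digests]
  rw [evalC_flatten, evalC_flatten] at hg1 hg2 hg3 hg4 hg5 hg6 hg7
  rw [evalC_flatten] at hr1 hr2 hr3 hr4 hr5 hr6
  simp only [List.map_cons, List.map_nil, List.sum_cons, List.sum_nil] at hg1 hg2 hg3 hg4 hg5 hg6 hg7 hr1 hr2 hr3 hr4 hr5 hr6 ⊢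
  linarith

end QCert
end HubOnly

end Summit.CriticalPhenomena.PercolationContinuityZ3.Theorems
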